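import Summits.ResolutionOfSingularities.ResolutionOfSingularities.Theorems.PurelyInseparableDim4StepKitState
import HarnessLib

/-!
# Purely inseparable fourfolds — STEP KIT (4): a `decide`-able TRAP checker with soundness
# (cell `res-dim4-pi`, W3-2 / W3-13 «kernel batch of the trap census»)

[OURS · counted 0 · instrument] Nothing here is a statement about resolution of singularities.
Continues the kit (`…StepKit`, `…StepKitTranslate`, `…StepKitState`).  A finite TRAP is presented as a
list of rows `(s, moves)`: `s : SData 4 K` a presented state and `moves` a list of
`(S, j, b, i)` = (coordinate centre, chart, chart point, index of the child row).  The Boolean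
`trapB q TW` checks, by structural recursion only, that every listed state has a `q`-fold origin and
that for EVERY Hironaka-permissible coordinate centre `S` (all `S ⊆ {x₁,…,x₄}` are enumerated) some
listed move along `S` is a legal edge — `j ∈ S`, `b j = 0`, equimultiple point, non-zero cleaned
transform — whose transform is LITERALLY the listed child (`moveB`).  **`isTrap_of_trapB`** transports
`trapB q TW = true` (settled by `decide`) to the tree's `PIDim4.IsTrap q (trapSet TW)`, hence
`¬ TerminatesSomeRule p q` (`not_terminatesSomeRule_of_trapB`) and, for every permissible rule `R`,
`¬ TerminatesUnder q R`.  Intended consumer: the literal S₄-closures of the engines' trap census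
(eng-w5 `traps_literal.json`; W3-13).  No instances; counted 0.
bears_on: LADDER-RESOLUTION:D157-DOOR2 (res-dim4-pi · W3-2 · W3-13). Supports stmt-ResolutionOfSingularities-16155 (helper).
-/

set_option linter.dupNamespace false -- mandated namespace of this single-conjunct summit

noncomputable section

open MvPolynomial Finset

namespace Summit.ResolutionOfSingularities.ResolutionOfSingularities.Theorems.PIDim4

namespace StepKit

open Literature.AlgebraicGeometry.Resolution
open Literature.AlgebraicGeometry.Resolution.CentreBlowup

variable {K : Type} [Field K] [DecidableEq K]

/-! ## §10 Trap rows and the checker -/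

/-- A move of player B recorded in a trap row: centre `S`, chart `j`, chart point `b`, child index. [folklore] -/
abbrev Move (K : Type) : Type := Finset (Fin 4) × Fin 4 × (Fin 4 → K) × ℕ

/-- A trap table: presented states with their recorded moves. [folklore] -/
abbrev TrapRows (K : Type) : Type := List (SData 4 K × List (Move K))

/-- The move `(S, j, b, i)` at the state `s` is a legal edge onto the `i`-th listed state:
`j ∈ S`, `b j = 0`, the point is equimultiple, the cleaned transform is non-zero and presents the same
state as row `i`. [folklore] -/
def moveB (q : ℕ) (TW : TrapRows K) (s : SData 4 K) (m : Move K) : Bool :=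
  decide (m.2.1 ∈ m.1) && decide (m.2.2.1 m.2.1 = 0) && equiB q m.1 m.2.1 m.2.2.1 s &&
    !(StepKit.equivB (stepD q m.1 m.2.1 m.2.2.1 s).L []) &&
    ((TW[m.2.2.2]?).elim false fun t => (stepD q m.1 m.2.1 m.2.2.1 s).equivB t.1)

/-- **The trap checker**: every listed state has a `q`-fold origin, and every Hironaka-permissible
coordinate centre is answered by a recorded legal move back into the list. [folklore] -/
def trapB (q : ℕ) (TW : TrapRows K) : Bool :=
  TW.all fun sw => permB q Finset.univ sw.1.L &&
    decide (∀ S : Finset (Fin 4), permB q S sw.1.L = true → ∃ m ∈ sw.2, m.1 = S ∧ moveB q TW sw.1 m = true)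

/-- The set of tree states presented by the table. [folklore] -/
def trapSet (TW : TrapRows K) : Set (State K) := {x | ∃ sw ∈ TW, sw.1.toState = x}

omit [DecidableEq K] in
/-- A listed row presents a member of `trapSet`. [folklore] -/
theorem mem_trapSet {TW : TrapRows K} {sw : SData 4 K × List (Move K)} (h : sw ∈ TW) :
    sw.1.toState ∈ trapSet TW := ⟨sw, h, rfl⟩

omit [DecidableEq K] in
/-- A non-empty table presents a non-empty set. [folklore] -/
theorem trapSet_nonempty {TW : TrapRows K} (h : TW ≠ []) : (trapSet TW).Nonempty := by
  obtain ⟨sw, hsw⟩ := List.exists_mem_of_ne_nil TW h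
  exact ⟨sw.1.toState, mem_trapSet hsw⟩

/-- Soundness of one move. [folklore] -/
theorem edge_of_moveB {q : ℕ} {TW : TrapRows K} {s : SData 4 K} {m : Move K}
    (h : moveB q TW s m = true) : ∃ s' ∈ trapSet TW, Edge q m.1 s.toState s' := by
  simp only [moveB, Bool.and_eq_true, decide_eq_true_eq, Bool.not_eq_true'] at h
  obtain ⟨⟨⟨⟨hj, hb⟩, h1⟩, h2⟩, h3⟩ := h
  cases hget : TW[m.2.2.2]? with
  | none => rw [hget] at h3; exact absurd h3 (by simp)
  | some t =>
    rw [hget] at h3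
    simp only [Option.elim] at h3
    exact ⟨t.1.toState, mem_trapSet (List.mem_of_getElem? hget), edge_of m.2.1 m.2.2.1 hj hb h1 h2 h3⟩

/-- **Soundness of the trap checker**: `trapB q TW = true` gives the tree's `IsTrap q (trapSet TW)`. [folklore] -/
theorem isTrap_of_trapB {q : ℕ} {TW : TrapRows K} (h : trapB q TW = true) : IsTrap q (trapSet TW) := by
  rintro x ⟨sw, hsw, rfl⟩
  simp only [trapB, List.all_eq_true, Bool.and_eq_true, decide_eq_true_eq] at h
  obtain ⟨hord, hall⟩ := h sw hsw
  refine ⟨((isPermissibleCentre_iff q Finset.univ sw.1.L).mpr hord).2, fun S hS => ?_⟩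
  obtain ⟨m, _, hmS, hmove⟩ := hall S ((isPermissibleCentre_iff q S sw.1.L).mp hS)
  obtain ⟨s', hs', hedge⟩ := edge_of_moveB hmove
  exact ⟨s', hs', hmS ▸ hedge⟩

/-- **A checked non-empty trap table over a field of characteristic `p` refutes `TerminatesSomeRule p q`.**
[folklore] -/
theorem not_terminatesSomeRule_of_trapB (p q : ℕ) [CharP K p] {TW : TrapRows K} (h : trapB q TW = true)
    (hne : TW ≠ []) : ¬ TerminatesSomeRule p q :=
  not_terminatesSomeRule_of_trap p q K (trapSet TW) (isTrap_of_trapB h) (trapSet_nonempty hne)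

/-- And defeats every permissible coordinate rule over that field. [folklore] -/
theorem not_terminatesUnder_of_trapB {q : ℕ} {TW : TrapRows K} (h : trapB q TW = true) (hne : TW ≠ [])
    (R : CentreRule K) (hR : IsPermissibleRule q R) : ¬ TerminatesUnder q R :=
  not_terminatesUnder_of_trap q (trapSet TW) (isTrap_of_trapB h) (trapSet_nonempty hne) R hR

/-! ## §11 Two worked rows (acceptance tests): T-002 and TRAP-1 at `p = q = 2` -/

/-- T-002 as a ONE-ROW table: `(x₃x₄ + x₂x₃ + x₂x₃x₄, 0, {x₂})`, both permissible centres (the line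
`{x₂,x₃,x₄}` and the point) answered by the `x₂`-chart point `x₄ = 1`. [folklore] -/
def t002 : TrapRows (ZMod 2) :=
  [(⟨[(![0, 0, 1, 1], 1), (![0, 1, 1, 0], 1), (![0, 1, 1, 1], 1)], ![0, 0, 0, 0], {1}⟩,
    [({1, 2, 3}, 1, ![0, 0, 0, 1], 0), (Finset.univ, 1, ![0, 0, 0, 1], 0)])]

/-- The T-002 table checks. -/
theorem trapB_t002 : trapB 2 t002 = true := by decide

-- (`not_terminatesSomeRule_of_trapB 2 2 trapB_t002 (by simp [t002]) : ¬ TerminatesSomeRule 2 2` is the landed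
-- `not_terminatesSomeRule_two` of `…CoordinateTrap`; not restated.)

/-- TRAP-1 (idea-3) as a one-row table: `(x₃x₄ + x₂x₃ + x₂x₃x₄ + x₁²x₂, 0, {x₂})`, only the point is
permissible, answered by the `x₂`-chart point `x₄ = 1` (`CoordinateTrap.step_s0`). [folklore] -/
def trap1 : TrapRows (ZMod 2) :=
  [(⟨[(![0, 0, 1, 1], 1), (![0, 1, 1, 0], 1), (![0, 1, 1, 1], 1), (![2, 1, 0, 0], 1)], ![0, 0, 0, 0], {1}⟩,
    [(Finset.univ, 1, ![0, 0, 0, 1], 0)])]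

/-- The TRAP-1 table checks. -/
theorem trapB_trap1 : trapB 2 trap1 = true := by decide

end StepKit

end Summit.ResolutionOfSingularities.ResolutionOfSingularities.Theorems.PIDim4

end
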